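import Mathlib

/-!
# Skew-cut certificate, contour form (format 3-W): the kernel-checkable algebra
(ns-blowup-cap g0, cell `ns-blowup`, 2026-08-25)

HONEST FRAMING (human ruling D-0035): nothing here is a claim about Navier–Stokes blow-up.
WHAT THIS IS NOT: not NS evidence. These are the finite-dimensional lemmas behind Theorem 3
(«COUNT») of `cap/SKEWCUT-PAIR.md` — the contour / winding-number form of selfsim's skew-cut
certificate (`selfsim/SKEWCUT-CERT.md`, kernel half `SkewCutCertificate.lean`) for ONE eigenpair of
the MODEL operator «NS linearised about the forced ABC flow» (crux X0 of lane N1*). The analytic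
steps (argument principle, strong resolvent convergence, Riesz projectors, Rellich) stay paper-grade
in that note; what is kernel here is exactly the COUPLING-HOMOTOPY step (i) of Theorem 3:

* `re_inner_homotopy_ge` — if the quadratic forms of `Λ` and of `Λ + Q` are both bounded below by
  `μ‖v‖²`, then so is the form of `Λ + τ • Q` for every `τ ∈ [0, 1]` (the form is affine in `τ`;
  this is the «concave in t²» step with `τ = t²`).
* `fromBlocks_smul_schur` — the Schur complement of `A` in the coupling homotopy
  `M_t = [[A, t•B], [t•C, D]]` is `D − t² • (C ⅟A B)`, and
  `det M_t = det A · det (D − t² • (C ⅟A B))` (`det_fromBlocks_homotopy`).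
* `det_ne_zero_of_re_quadForm_pos` — a complex square matrix whose quadratic form has positive real
  part on nonzero vectors is nonsingular (the complex-parameter replacement of
  `SkewCutCertificate.det_pos_of_dotProduct_mulVec_pos`, which needs reality).
* `det_fromBlocks_homotopy_ne_zero` — the three combined: `det A ≠ 0` and strict accretivity of
  every homotopy Schur complement give `det M_t ≠ 0` for all `t ∈ [0,1]`, which is what makes the
  winding number of `z ↦ det M_t(z)` independent of `t`.
* `eigenvalue_im_eq` — the one-line identity behind LEMMA 6.1 (a-priori box): for `T v = λ • v`,
  `‖v‖ = 1`, `λ = ⟪v, T v⟫`, so `im λ` is the sum of the `im` parts of the forms of any splitting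
  `T = A + B`.

* (appended) `abs_re_inner_rankOne_le`, `re_inner_sub_rankOne_ge` — §9 (N4) rank-one tail term of the
  NESTED-HEAD bordered certificate; `im_eq_zero_of_isolated_of_conj_mem`, `norm_conj_sub_self_le` —
  §9 (N7) reality by isolation.

Mathlib only; no new definitions.
-/

namespace Summit.NavierStokesRegularity.FluidComputer.SkewCutContour

open scoped ComplexOrder
open Matrix RCLike

section Forms

variable {𝕜 E : Type*} [RCLike 𝕜] [NormedAddCommGroup E] [InnerProductSpace 𝕜 E]

/-- **Homotopy lower bound (Theorem 3 (i)).** If `μ‖v‖² ≤ re ⟪Λ v, v⟫` and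
`μ‖v‖² ≤ re ⟪(Λ + Q) v, v⟫` for all `v`, then `μ‖v‖² ≤ re ⟪(Λ + τ•Q) v, v⟫` for every
`τ ∈ [0,1]`: the form is an affine function of `τ`, so its infimum over unit vectors is concave and
bounded below on `[0,1]` by the smaller endpoint value. -/
theorem re_inner_homotopy_ge (Λ Q : E →ₗ[𝕜] E) (μ τ : ℝ) (hτ0 : 0 ≤ τ) (hτ1 : τ ≤ 1)
    (h0 : ∀ v : E, μ * ‖v‖ ^ 2 ≤ re (inner 𝕜 (Λ v) v))
    (h1 : ∀ v : E, μ * ‖v‖ ^ 2 ≤ re (inner 𝕜 ((Λ + Q) v) v)) (v : E) :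
    μ * ‖v‖ ^ 2 ≤ re (inner 𝕜 ((Λ + (τ : 𝕜) • Q) v) v) := by
  have hΛ := h0 v
  have hΛQ := h1 v
  have hdecomp : re (inner 𝕜 ((Λ + (τ : 𝕜) • Q) v) v)
      = (1 - τ) * re (inner 𝕜 (Λ v) v) + τ * re (inner 𝕜 ((Λ + Q) v) v) := by
    simp only [LinearMap.add_apply, LinearMap.smul_apply, inner_add_left, inner_smul_left,
      map_add, RCLike.conj_ofReal, RCLike.re_ofReal_mul]
    ring
  rw [hdecomp]
  nlinarith

/-- **Eigenvalue identity (Lemma 6.1).** If `T v = λ • v` with `‖v‖ = 1` then `λ = ⟪v, T v⟫`. -/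
theorem eigenvalue_eq_inner (T : E →ₗ[𝕜] E) (v : E) (lam : 𝕜) (hv : ‖v‖ = 1)
    (h : T v = lam • v) : lam = inner 𝕜 v (T v) := by
  rw [h, inner_smul_right, inner_self_eq_norm_sq_to_K, hv]
  simp

/-- **Splitting of the imaginary part (Lemma 6.1).** For `T = A + B`, `T v = λ • v`, `‖v‖ = 1`:
`im λ = im ⟪v, A v⟫ + im ⟪v, B v⟫`; with a skew `A` (purely imaginary form bounded by `‖U‖_∞‖∇v‖`)
and a bounded `B` this is the a-priori strip for unstable eigenvalues. -/
theorem eigenvalue_im_eq (A B : E →ₗ[𝕜] E) (v : E) (lam : 𝕜) (hv : ‖v‖ = 1)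
    (h : (A + B) v = lam • v) :
    im lam = im (inner 𝕜 v (A v)) + im (inner 𝕜 v (B v)) := by
  have := eigenvalue_eq_inner (A + B) v lam hv h
  rw [this, LinearMap.add_apply, inner_add_right, map_add]

end Forms

section Blocks

variable {m n : Type*} [Fintype m] [Fintype n] [DecidableEq m] [DecidableEq n]

omit [Fintype n] [DecidableEq n] in
/-- **Schur complement of the coupling homotopy.** For `M_t = [[A, t•B],[t•C, D]]` with `A`
invertible, `(t•C) ⅟A (t•B) = t² • (C ⅟A B)`. -/
theorem fromBlocks_smul_schur (A : Matrix m m ℂ) [Invertible A] (B : Matrix m n ℂ)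
    (C : Matrix n m ℂ) (t : ℂ) :
    (t • C) * ⅟A * (t • B) = (t ^ 2) • (C * ⅟A * B) := by
  rw [Matrix.smul_mul, Matrix.smul_mul, Matrix.mul_smul, smul_smul, pow_two]

/-- **Determinant of the coupling homotopy.** `det [[A, t•B],[t•C, D]] = det A · det (D − t²•(C ⅟A B))`. -/
theorem det_fromBlocks_homotopy (A : Matrix m m ℂ) [Invertible A] (B : Matrix m n ℂ)
    (C : Matrix n m ℂ) (D : Matrix n n ℂ) (t : ℂ) :
    (Matrix.fromBlocks A (t • B) (t • C) D).det = A.det * (D - (t ^ 2) • (C * ⅟A * B)).det := by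
  rw [Matrix.det_fromBlocks₁₁, fromBlocks_smul_schur]

/-- **Strictly accretive ⇒ nonsingular (complex form of Lemma 3.3).** If the quadratic form of a
complex square matrix `Z` has positive real part on every nonzero vector, then `det Z ≠ 0`. -/
theorem det_ne_zero_of_re_quadForm_pos (Z : Matrix n n ℂ)
    (hZ : ∀ v : n → ℂ, v ≠ 0 → 0 < (star v ⬝ᵥ Z *ᵥ v).re) : Z.det ≠ 0 := by
  intro hdet
  obtain ⟨v, hv0, hv⟩ := Matrix.exists_mulVec_eq_zero_iff.mpr hdet
  have := hZ v hv0
  rw [hv, dotProduct_zero, Complex.zero_re] at this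
  exact lt_irrefl 0 this

/-- **Theorem 3 (i), finite core.** If `A` is invertible and, for every `t ∈ [0,1]`, the homotopy
Schur complement `D − t²•(C ⅟A B)` is strictly accretive, then `det M_t ≠ 0` for all `t ∈ [0,1]`
(so the winding number of `z ↦ det M_t(z)` along a contour cannot change with `t`). -/
theorem det_fromBlocks_homotopy_ne_zero (A : Matrix m m ℂ) [Invertible A] (B : Matrix m n ℂ)
    (C : Matrix n m ℂ) (D : Matrix n n ℂ)
    (hS : ∀ t : ℝ, 0 ≤ t → t ≤ 1 →
      ∀ v : n → ℂ, v ≠ 0 → 0 < (star v ⬝ᵥ (D - ((t : ℂ) ^ 2) • (C * ⅟A * B)) *ᵥ v).re)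
    (t : ℝ) (ht0 : 0 ≤ t) (ht1 : t ≤ 1) :
    (Matrix.fromBlocks A ((t : ℂ) • B) ((t : ℂ) • C) D).det ≠ 0 := by
  rw [det_fromBlocks_homotopy]
  refine mul_ne_zero ?_ (det_ne_zero_of_re_quadForm_pos _ (hS t ht0 ht1))
  exact (Matrix.isUnit_det_of_invertible A).ne_zero

end Blocks

section NestedHead

/-! ### Appended 2026-08-25 (cap g0): the algebraic core of `SKEWCUT-PAIR.md` §9 (N4) and (N7)

(N4) In the NESTED-HEAD bordered certificate the border column `ṽ` has a tail part `t = ṽ_t`, which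
feeds the eliminated `μ`-slot into the tail Schur complement as ONE rank-one term
`w ↦ (g w) • t` (with `g = B_K* (μ-row of Â₀⁻¹)` a bounded functional). The two lemmas below are the
whole estimate: the rank-one term moves the real part of the quadratic form by at most
`‖g‖ ‖t‖ ‖w‖²`, so a coercivity constant `μ` survives as `μ − ‖g‖ ‖t‖`.
(N7) Reality by isolation: if the spectrum near `λ*` is `{λ*}` within radius `r`, the spectrum is
closed under conjugation, and `|conj λ* − λ*| < r`, then `λ*` is real — stated for an abstract set. -/

variable {𝕜 E : Type*} [RCLike 𝕜] [NormedAddCommGroup E] [InnerProductSpace 𝕜 E]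

/-- **(N4) rank-one form bound.** For a bounded linear functional `g`, a vector `t` and any `w`:
`|re ⟪(g w) • t, w⟫| ≤ ‖g‖ ‖t‖ ‖w‖²`. -/
theorem abs_re_inner_rankOne_le (g : E →L[𝕜] 𝕜) (t w : E) :
    |re (inner 𝕜 ((g w) • t) w)| ≤ ‖g‖ * ‖t‖ * ‖w‖ ^ 2 := by
  have h1 : |re (inner 𝕜 ((g w) • t) w)| ≤ ‖inner 𝕜 ((g w) • t) w‖ := RCLike.abs_re_le_norm _
  have h2 : ‖inner 𝕜 ((g w) • t) w‖ ≤ ‖(g w) • t‖ * ‖w‖ := norm_inner_le_norm _ _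
  have h3 : ‖(g w) • t‖ = ‖g w‖ * ‖t‖ := norm_smul _ _
  have h4 : ‖g w‖ ≤ ‖g‖ * ‖w‖ := g.le_opNorm w
  have ht : 0 ≤ ‖t‖ := norm_nonneg _
  have hw : 0 ≤ ‖w‖ := norm_nonneg _
  calc |re (inner 𝕜 ((g w) • t) w)| ≤ ‖(g w) • t‖ * ‖w‖ := h1.trans h2
    _ = ‖g w‖ * ‖t‖ * ‖w‖ := by rw [h3]
    _ ≤ ‖g‖ * ‖w‖ * ‖t‖ * ‖w‖ := by gcongr
    _ = ‖g‖ * ‖t‖ * ‖w‖ ^ 2 := by ring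

/-- **(N4) coercivity survives a rank-one perturbation.** If `re ⟪Z w, w⟫ ≥ μ ‖w‖²` for all `w`, then the
perturbed map `w ↦ Z w − (g w) • t` satisfies `re ⟪Z w − (g w) • t, w⟫ ≥ (μ − ‖g‖ ‖t‖) ‖w‖²`. -/
theorem re_inner_sub_rankOne_ge (Z : E →ₗ[𝕜] E) (g : E →L[𝕜] 𝕜) (t : E) (μ : ℝ)
    (hZ : ∀ w : E, μ * ‖w‖ ^ 2 ≤ re (inner 𝕜 (Z w) w)) (w : E) :
    (μ - ‖g‖ * ‖t‖) * ‖w‖ ^ 2 ≤ re (inner 𝕜 (Z w - (g w) • t) w) := by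
  have h := abs_re_inner_rankOne_le (𝕜 := 𝕜) g t w
  have hsplit : re (inner 𝕜 (Z w - (g w) • t) w) = re (inner 𝕜 (Z w) w) - re (inner 𝕜 ((g w) • t) w) := by
    rw [inner_sub_left, map_sub]
  rw [hsplit]
  have hb := (abs_le.mp h).2
  nlinarith [hZ w]

/-- **(N7) reality by isolation (abstract).** Let `S ⊆ ℂ` be closed under complex conjugation and let
`λ ∈ S` be isolated in `S` with radius `r` (every point of `S` within distance `r` of `λ` equals `λ`). If
`|conj λ − λ| < r` — e.g. because both `λ` and `conj λ` lie within `ρ` of a REAL approximation and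
`2ρ < r` — then `λ` is real. -/
theorem im_eq_zero_of_isolated_of_conj_mem (S : Set ℂ) (lam : ℂ) (r : ℝ)
    (hconj : ∀ z ∈ S, (starRingEnd ℂ) z ∈ S) (hmem : lam ∈ S)
    (hiso : ∀ z ∈ S, ‖z - lam‖ < r → z = lam)
    (hnear : ‖(starRingEnd ℂ) lam - lam‖ < r) : lam.im = 0 := by
  have hfix : (starRingEnd ℂ) lam = lam := hiso _ (hconj _ hmem) hnear
  have := Complex.conj_eq_iff_im.mp hfix
  exact this

/-- **(N7), the distance step.** If `λ̃` is real and `‖λ − λ̃‖ ≤ ρ` then `‖conj λ − λ‖ ≤ 2ρ`. -/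
theorem norm_conj_sub_self_le (lam : ℂ) (lt : ℝ) (ρ : ℝ) (h : ‖lam - (lt : ℂ)‖ ≤ ρ) :
    ‖(starRingEnd ℂ) lam - lam‖ ≤ 2 * ρ := by
  have h1 : ‖(starRingEnd ℂ) lam - (lt : ℂ)‖ ≤ ρ := by
    have : (starRingEnd ℂ) lam - (lt : ℂ) = (starRingEnd ℂ) (lam - (lt : ℂ)) := by
      simp [map_sub, Complex.conj_ofReal]
    rw [this, Complex.norm_conj]; exact h
  calc ‖(starRingEnd ℂ) lam - lam‖ = ‖((starRingEnd ℂ) lam - (lt : ℂ)) - (lam - (lt : ℂ))‖ := by ring_nf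
    _ ≤ ‖(starRingEnd ℂ) lam - (lt : ℂ)‖ + ‖lam - (lt : ℂ)‖ := norm_sub_le _ _
    _ ≤ ρ + ρ := add_le_add h1 h
    _ = 2 * ρ := by ring

end NestedHead

end Summit.NavierStokesRegularity.FluidComputer.SkewCutContour
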